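import Literature.NumberTheory.Transcendental.KZLogCalculusProofs
import Literature.NumberTheory.Transcendental.KZDominatedFamilyRelations
import Literature.NumberTheory.Transcendental.KZMellinFibres

/-!
# `NormalFormPrinciple` (stmt-KontsevichZagierPeriods-3869), line `SketchIdeator1` — the leaf
# `stub_boxRigidity` on the level-one box tower: the merge gadget with spectators (rule 2)

Registered sub-goal `merge_box_sub_band_dim` of the level-one box tower
`[(0,1)^{w+2}, P(x)/(1 − x₀⋯x_{w+1})]` (lead file `…LevelOneTower`). Write a point of `ℝ^{w+2}` as
`(x, y, t)` with spectators `x = Fin.init (Fin.init z) ∈ ℝʷ`, `y = z (Fin.castSucc (Fin.last w))` and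
`t = z (Fin.last (w+1))`. For `b < a` and `c ∈ ℚ`, the box monomial
`N = [(0,1)^{w+2}, c xᵉ yᵃ tᵇ/(1 − (∏ x) y t)]` and the band representation
`R = [T, c xᵉ y^{a−b−1} tᵇ/(1 − (∏ x) t)]`, `T = {(x, y) ∈ (0,1)^{w+1}, 0 ≤ t ≤ y}`, differ by a
relation:

1. (rule 1) `N` agrees on the open box with the representation `r = [B₀, c xᵉ yᵃ tᵇ/(1 − (∏ x) y t)]`
   on the band-box `B₀ = {(x, y) ∈ (0,1)^{w+1}, 0 ≤ t ≤ 1}`, and `B₀ ∖ (0,1)^{w+2}` consists of the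
   two null faces `t ∈ {0, 1}` (`KZ.IntegralRep.of_sub_of_restrict_mem_relations`,
   `KZ.of_sub_of_mem_relations_of_eqOn`);
2. (rule 2) the substitution `t ↦ y t` along the last coordinate over the open base `(0,1)^{w+1}`
   (`KZ.of_sub_of_mem_relations_of_affine` with `α = 0`, `β = y`, Jacobian `y`) carries `B₀` onto
   `T`, and `c xᵉ y^{a−b−1} (y t)ᵇ/(1 − (∏ x) y t) · y = c xᵉ yᵃ tᵇ/(1 − (∏ x) y t)`.

This is the dimension-two merge gadget `merge_box_sub_triangle` (file
`…LevelOneMergeBoxSubTriangle`) with spectators. References: M. Kontsevich, D. Zagier, *Periods*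
(2001), §1.2 rules (1), (2). No definitions are introduced.
-/

noncomputable section

open MeasureTheory Set
open Literature.NumberTheory.Transcendental Literature.NumberTheory.Transcendental.KZ
open Literature.ModelTheory.ExponentialFields (IsSemialgebraic)

namespace Summit.KontsevichZagierPeriods.HurwitzMicroSectors.NormalFormPrinciple.PiBox.LevelOne

/-- The merge identity with spectators:
`c S yᵃ tᵇ/(1 − P y t) = c S y^{a−b−1} (y t)ᵇ/(1 − P (y t)) · y` for `b < a`
(`a = (a − b − 1) + b + 1`). [folklore] -/
theorem merge_identity_dim {a b : ℕ} (hab : b < a) (c S P y t : ℝ) :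
    c * (S * (y ^ a * t ^ b)) / (1 - P * y * t) =
      c * (S * (y ^ (a - b - 1) * (y * t) ^ b)) / (1 - P * (y * t)) * y := by
  obtain ⟨k, rfl⟩ : ∃ k, a = b + 1 + k := ⟨a - (b + 1), by omega⟩
  have hk : b + 1 + k - b - 1 = k := by omega
  rw [hk, ← mul_assoc P y t]
  ring

/-- The product of all `w + 2` coordinates splits off the last two:
`∏ᵢ zᵢ = (∏ spectators) · z_{w} · z_{w+1}` (`Fin.prod_univ_castSucc` twice). [folklore] -/
theorem prod_univ_eq_spect_mul_dim {w : ℕ} (z : Fin (w + 2) → ℝ) :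
    ∏ i, z i = (∏ i, Fin.init (Fin.init z) i) * z (Fin.castSucc (Fin.last w)) *
      z (Fin.last (w + 1)) := by
  rw [Fin.prod_univ_castSucc, Fin.prod_univ_castSucc]
  rfl

/-- **The merge gadget with spectators** (Kontsevich–Zagier rule 2; registered sub-goal T2 of the
level-one box tower of `stub_boxRigidity`). In coordinates `(x, y, t) ∈ ℝʷ × ℝ × ℝ`, for `b < a` the
box representation `N = [(0,1)^{w+2}, c xᵉ yᵃ tᵇ/(1 − (∏ x) y t)]` and the band representation
`R = [T, c xᵉ y^{a−b−1} tᵇ/(1 − (∏ x) t)]`, `T = {(x, y) ∈ (0,1)^{w+1}, 0 ≤ t ≤ y}`, differ by a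
relation: `N` is congruent (rule 1, two null faces `t ∈ {0, 1}`) to the same integrand on the
band-box `{(x, y) ∈ (0,1)^{w+1}, 0 ≤ t ≤ 1}`, which the substitution `t ↦ y t` along the last
coordinate (`KZ.of_sub_of_mem_relations_of_affine`, `α = 0`, `β = y`, Jacobian `y`) carries onto `T`
with `c xᵉ y^{a−b−1} (y t)ᵇ/(1 − (∏ x) y t) · y = c xᵉ yᵃ tᵇ/(1 − (∏ x) y t)`.
[cite: KontsevichZagier2001, §1.2 rules (1), (2)] -/
theorem merge_box_sub_band_dim {w : ℕ} (e : Fin w → ℕ) (a b : ℕ) (c : ℚ) (hab : b < a)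
    (N R : IntegralRep (w + 2))
    (hNd : N.domain = {x | ∀ i, x i ∈ Set.Ioo (0:ℝ) 1})
    (hNi : EqOn N.integrand (fun z => (c : ℝ) * ((∏ i, Fin.init (Fin.init z) i ^ e i) *
        (z (Fin.castSucc (Fin.last w)) ^ a * z (Fin.last (w + 1)) ^ b)) / (1 - ∏ i, z i)) N.domain)
    (hRd : R.domain = KZlog.band {y : Fin (w + 1) → ℝ | ∀ i, y i ∈ Set.Ioo (0:ℝ) 1} (fun _ => (0:ℝ))
        (fun y => y (Fin.last w)))
    (hRi : EqOn R.integrand (fun z => (c : ℝ) * ((∏ i, Fin.init (Fin.init z) i ^ e i) *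
        (z (Fin.castSucc (Fin.last w)) ^ (a - b - 1) * z (Fin.last (w + 1)) ^ b)) /
        (1 - (∏ i, Fin.init (Fin.init z) i) * z (Fin.last (w + 1)))) R.domain) :
    of N - of R ∈ relations := by
  -- the open base `G = (0,1)^{w+1}` and the band-box `B₀ = {init z ∈ G, 0 ≤ z_last ≤ 1}` over it
  have hG : IsSemialgebraic ℚ {y : Fin (w + 1) → ℝ | ∀ i, y i ∈ Set.Ioo (0:ℝ) 1} :=
    isSemialgebraic_box (w + 1)
  have hGo : IsOpen {y : Fin (w + 1) → ℝ | ∀ i, y i ∈ Set.Ioo (0:ℝ) 1} := by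
    rw [Set.setOf_forall]
    exact isOpen_iInter_of_finite fun i => isOpen_Ioo.preimage (continuous_apply i)
  have hα : IsSemialgebraicFunOn ℚ {y : Fin (w + 1) → ℝ | ∀ i, y i ∈ Set.Ioo (0:ℝ) 1}
      (fun _ => (0:ℝ)) := by
    simpa using isSemialgebraicFunOn_ratCast hG 0
  have hone : IsSemialgebraicFunOn ℚ {y : Fin (w + 1) → ℝ | ∀ i, y i ∈ Set.Ioo (0:ℝ) 1}
      (fun _ => (1:ℝ)) := by
    simpa using isSemialgebraicFunOn_ratCast hG 1
  have hβ : IsSemialgebraicFunOn ℚ {y : Fin (w + 1) → ℝ | ∀ i, y i ∈ Set.Ioo (0:ℝ) 1}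
      (fun y => y (Fin.last w)) :=
    isSemialgebraicFunOn_apply hG (Fin.last w)
  have hB : IsSemialgebraic ℚ (KZlog.band {y : Fin (w + 1) → ℝ | ∀ i, y i ∈ Set.Ioo (0:ℝ) 1}
      (fun _ => (0:ℝ)) (fun _ => (1:ℝ))) :=
    KZlog.isSemialgebraic_band hα hone
  -- coordinates of a point of the band-box: `init z ∈ (0,1)^{w+1}`, `z_last ∈ [0,1]`
  have hmemB : ∀ z ∈ KZlog.band {y : Fin (w + 1) → ℝ | ∀ i, y i ∈ Set.Ioo (0:ℝ) 1}
      (fun _ => (0:ℝ)) (fun _ => (1:ℝ)),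
      (∀ i : Fin (w + 1), z (Fin.castSucc i) ∈ Set.Ioo (0:ℝ) 1) ∧ 0 ≤ z (Fin.last (w + 1)) ∧
        z (Fin.last (w + 1)) ≤ 1 :=
    fun z hz => hz
  -- the denominator `1 − ∏ z` is positive on the band-box
  have hden : ∀ z ∈ KZlog.band {y : Fin (w + 1) → ℝ | ∀ i, y i ∈ Set.Ioo (0:ℝ) 1}
      (fun _ => (0:ℝ)) (fun _ => (1:ℝ)), ∏ i, z i < 1 := by
    intro z hz
    obtain ⟨hzG, h0, h1⟩ := hmemB z hz
    have hy := hzG (Fin.last w)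
    have hS0 : 0 ≤ ∏ i, Fin.init (Fin.init z) i :=
      Finset.prod_nonneg fun i _ => (hzG (Fin.castSucc i)).1.le
    have hS1 : ∏ i, Fin.init (Fin.init z) i ≤ 1 :=
      Finset.prod_le_one (fun i _ => (hzG (Fin.castSucc i)).1.le)
        fun i _ => (hzG (Fin.castSucc i)).2.le
    rw [prod_univ_eq_spect_mul_dim z]
    calc (∏ i, Fin.init (Fin.init z) i) * z (Fin.castSucc (Fin.last w)) * z (Fin.last (w + 1))
        ≤ (∏ i, Fin.init (Fin.init z) i) * z (Fin.castSucc (Fin.last w)) :=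
          mul_le_of_le_one_right (mul_nonneg hS0 hy.1.le) h1
      _ ≤ z (Fin.castSucc (Fin.last w)) := mul_le_of_le_one_left hy.1.le hS1
      _ < 1 := hy.2
  -- the explicit box integrand is semialgebraic on the band-box (a rational function whose
  -- denominator is positive there)
  have hsa : IsSemialgebraicFunOn ℚ
      (KZlog.band {y : Fin (w + 1) → ℝ | ∀ i, y i ∈ Set.Ioo (0:ℝ) 1} (fun _ => (0:ℝ))
        (fun _ => (1:ℝ)))
      (fun z => (c : ℝ) * ((∏ i, Fin.init (Fin.init z) i ^ e i) *
        (z (Fin.castSucc (Fin.last w)) ^ a * z (Fin.last (w + 1)) ^ b)) / (1 - ∏ i, z i)) := by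
    refine (isSemialgebraicFunOn_aeval_div_aeval hB
      (MvPolynomial.C c * ((∏ i : Fin w, MvPolynomial.X (Fin.castSucc (Fin.castSucc i)) ^ e i) *
        (MvPolynomial.X (Fin.castSucc (Fin.last w)) ^ a * MvPolynomial.X (Fin.last (w + 1)) ^ b)))
      (1 - ∏ i, MvPolynomial.X i) fun x hx => ?_).congr fun x _ => ?_
    · have h : MvPolynomial.aeval x (1 - ∏ i, MvPolynomial.X i : MvPolynomial (Fin (w + 2)) ℚ) =
          1 - ∏ i, x i := by
        simp only [map_sub, map_one, map_prod, MvPolynomial.aeval_X]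
      rw [h]
      exact (sub_pos.2 (hden x hx)).ne'
    · simp only [map_mul, map_prod, map_pow, MvPolynomial.aeval_X, MvPolynomial.aeval_C, map_sub,
        map_one, eq_ratCast]
      rfl
  -- ... and integrable there: the band-box is the open box plus two null faces
  have hNint : IntegrableOn (fun z : Fin (w + 2) → ℝ => (c : ℝ) *
      ((∏ i, Fin.init (Fin.init z) i ^ e i) *
        (z (Fin.castSucc (Fin.last w)) ^ a * z (Fin.last (w + 1)) ^ b)) / (1 - ∏ i, z i))
      N.domain :=
    N.integrableOn.congr_fun hNi (IntegralRep.measurableSet_domain_holds N)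
  have hsub : KZlog.band {y : Fin (w + 1) → ℝ | ∀ i, y i ∈ Set.Ioo (0:ℝ) 1} (fun _ => (0:ℝ))
      (fun _ => (1:ℝ)) ⊆
      N.domain ∪ ({z | z (Fin.last (w + 1)) = 0} ∪ {z | z (Fin.last (w + 1)) = 1}) := by
    intro z hz
    obtain ⟨hzG, h0, h1⟩ := hmemB z hz
    rcases h0.eq_or_lt with h0 | h0
    · exact Or.inr (Or.inl h0.symm)
    rcases h1.lt_or_eq with h1 | h1
    · refine Or.inl ?_
      rw [hNd, Set.mem_setOf_eq]
      intro i
      exact Fin.lastCases ⟨h0, h1⟩ (fun j => hzG j) i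
    · exact Or.inr (Or.inr h1)
  have hint : IntegrableOn (fun z : Fin (w + 2) → ℝ => (c : ℝ) *
      ((∏ i, Fin.init (Fin.init z) i ^ e i) *
        (z (Fin.castSucc (Fin.last w)) ^ a * z (Fin.last (w + 1)) ^ b)) / (1 - ∏ i, z i))
      (KZlog.band {y : Fin (w + 1) → ℝ | ∀ i, y i ∈ Set.Ioo (0:ℝ) 1} (fun _ => (0:ℝ))
        (fun _ => (1:ℝ))) :=
    (hNint.union ((IntegrableOn.of_measure_zero (volume_setOf_last_eq_zero 0)).union
      (IntegrableOn.of_measure_zero (volume_setOf_last_eq_zero 1)))).mono_set hsub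
  -- the representation `r = [B₀, c xᵉ yᵃ tᵇ/(1 − ∏ z)]`
  obtain ⟨r, hrd, hri⟩ : ∃ r : IntegralRep (w + 2),
      r.domain = KZlog.band {y : Fin (w + 1) → ℝ | ∀ i, y i ∈ Set.Ioo (0:ℝ) 1} (fun _ => (0:ℝ))
        (fun _ => (1:ℝ)) ∧
      r.integrand = fun z => (c : ℝ) * ((∏ i, Fin.init (Fin.init z) i ^ e i) *
        (z (Fin.castSucc (Fin.last w)) ^ a * z (Fin.last (w + 1)) ^ b)) / (1 - ∏ i, z i) :=
    ⟨⟨_, _, hB, hsa, hint⟩, rfl, rfl⟩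
  -- (rule 1) `N` versus `r`: restriction to the open box and congruence
  have hEr : N.domain ⊆ r.domain := by
    intro z hz
    rw [hNd, Set.mem_setOf_eq] at hz
    rw [hrd]
    show (∀ i, Fin.init z i ∈ Set.Ioo (0:ℝ) 1) ∧ 0 ≤ z (Fin.last (w + 1)) ∧
      z (Fin.last (w + 1)) ≤ 1
    exact ⟨fun i => hz (Fin.castSucc i), (hz _).1.le, (hz _).2.le⟩
  have hnull : volume (r.domain \ N.domain) = 0 := by
    refine measure_mono_null (fun z hz => ?_)
      (measure_union_null (volume_setOf_last_eq_zero (n := w + 1) 0)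
        (volume_setOf_last_eq_zero (n := w + 1) 1))
    rcases hsub (hrd ▸ hz.1) with h | h
    · exact absurd h hz.2
    · exact h
  have e1 : of r - of (r.restrict N.domain N.isSemialgebraic_domain hEr) ∈ relations :=
    r.of_sub_of_restrict_mem_relations N.isSemialgebraic_domain hEr hnull
  have e2 : of N - of (r.restrict N.domain N.isSemialgebraic_domain hEr) ∈ relations :=
    of_sub_of_mem_relations_of_eqOn rfl (by rw [IntegralRep.integrand_restrict, hri]; exact hNi)
  -- (rule 2) `r` versus `R`: the substitution `t ↦ y t` along the last coordinate
  have key : ∀ z ∈ r.domain, r.integrand z =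
      R.integrand (Fin.snoc (Fin.init z) (0 + Fin.init z (Fin.last w) * z (Fin.last (w + 1)))) *
        Fin.init z (Fin.last w) := by
    intro z hz
    rw [hrd] at hz
    obtain ⟨hzG, h0, h1⟩ := hmemB z hz
    have hy : 0 < Fin.init z (Fin.last w) ∧ Fin.init z (Fin.last w) < 1 := hzG (Fin.last w)
    have hw : (Fin.snoc (Fin.init z) (0 + Fin.init z (Fin.last w) * z (Fin.last (w + 1))) :
        Fin (w + 2) → ℝ) ∈ R.domain := by
      rw [hRd]
      refine KZlog.mem_band.2 ?_
      rw [Fin.init_snoc, Fin.snoc_last]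
      refine ⟨hz.1, ?_, ?_⟩
      · show (0:ℝ) ≤ 0 + Fin.init z (Fin.last w) * z (Fin.last (w + 1))
        rw [zero_add]
        exact mul_nonneg hy.1.le h0
      · show 0 + Fin.init z (Fin.last w) * z (Fin.last (w + 1)) ≤ Fin.init z (Fin.last w)
        rw [zero_add]
        exact mul_le_of_le_one_right hy.1.le h1
    rw [hRi hw, hri]
    simp only [Fin.init_snoc, Fin.snoc_castSucc, Fin.snoc_last, zero_add]
    rw [prod_univ_eq_spect_mul_dim z]
    exact merge_identity_dim hab (c : ℝ) _ _ _ _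
  have e3 : of r - of R ∈ relations :=
    of_sub_of_mem_relations_of_affine (m := w + 1) hGo (α := fun _ => (0:ℝ))
      (β := fun y => y (Fin.last w)) (a := fun _ => (0:ℝ)) (b := fun _ => (1:ℝ))
      (a' := fun _ => (0:ℝ)) (b' := fun y => y (Fin.last w)) hα hβ (differentiableOn_const 0)
      (differentiableOn_apply (Fin.last w) _) (fun y hy => (hy (Fin.last w)).1) r R hrd hRd
      (fun y _ => by ring) (fun y _ => by ring) key
  -- bookkeeping
  have e : of N - of R = (of N - of (r.restrict N.domain N.isSemialgebraic_domain hEr)) -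
      (of r - of (r.restrict N.domain N.isSemialgebraic_domain hEr)) + (of r - of R) := by
    abel
  rw [e]
  exact relations.add_mem (relations.sub_mem e2 e1) e3

end Summit.KontsevichZagierPeriods.HurwitzMicroSectors.NormalFormPrinciple.PiBox.LevelOne
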